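import Summits.BirchSwinnertonDyer.BirchSwinnertonDyer.Theorems.PrintCFramBottomClassIndexLawFiveLeParitySplitPrimitivityFieldFactor
import Summits.BirchSwinnertonDyer.Rank1Residual.Partition.CornersCM
import Literature.NumberTheory.EllipticCurves.HeegnerPoints
import HarnessLib

/-!
# Crux `PrintCFram.BottomClassIndexLawFiveLe` (stmt-BirchSwinnertonDyer-20372), line `eisenstein-resource-bdp-line` (registry v19), stub B1
# `stub_bsdp_of_classFactor`: THE KOLYVAGIN READING OF B1 — B1 ⟸ «BSD_p on the members with Ш[p] ≠ 0» ∧ «the Heegner point is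
# p-PRIMITIVE up to the Manin-type constant on the members with Ш[p] = 0» ∧ «a p-regular admissible Heegner twist exists», MAZUR–WILES-FREE;
# and the primitivity statement is NECESSARY for BSD_p on the class
# (cell `bsd-print-cfram`, width seat `bsd-line-cfram-p1-w3` g10; THEOREMS ONLY, `--supports` 20372; BSD is not proved by any of this)

HONEST FRAMING. THEOREMS ONLY (0 defs / 0 facts / 0 sorry); nothing about BSD is proved unconditionally; no stub is closed; no summit
statement is proved by this seat; the crux C2 stays OPEN and is NOT claimed false. This is w3 g9's named successor task (crux notes
`Lines/eisenstein-resource-bdp-line-w3g9-notes.md` §2(c), «the LEAD's call, not done»): the LEAD g11 binder split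
`EisensteinEndStateV19Binders.stubB1_iff_stubB1Level_and_stubB1Sha` (**B1 ⟺ B1-level ∧ B1-sha**, the converse modulo Mazur–Wiles Thm 2)
read through w3 g8's character-free iff `ParitySplit.bsdp_iff_heegnerIndex_cmRamified` («on the branch `Ш(W)[p] = 0` with a `p`-regular
admissible Heegner twist, `BSDp W p ↔ ord_p [W(K):ℤP] = v_p(c)`»). The three research statements displayed as hypotheses are

* **B1-sha** (LEAD g11's text, verbatim) := «∀ class member `W` (CM, globally minimal, `CMRamified W p`, `p ≥ 5`, `r_an(W) = 1`) with
  `∃ s ∈ Ш(W/ℚ), s ≠ 0 ∧ p • s = 0`: `BSDp W p`»;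
* **B1-prim** (NEW TEXT; Kolyvagin's conjecture, first layer, up to the Manin-type constant `c` of the parametrisation datum) := «∀ class member
  `W` with `r_an(W) = 1` and `Ш(W/ℚ)[p] = 0`, ∀ admissible Heegner datum `(N = N_W, K, Dt, H, ι, P)` (`d_K` odd `< −4`, `L(W^{(d_K)},1) ≠ 0`,
  `P ↦ heegnerPointComplex Dt H`), ∀ globally minimal model `Wd` of the twist with `Ш(Wd/ℚ)[p] = 0`:
  `padicValNat p [W(K):ℤP] = padicValNat p c`» — NO Dirichlet character, NO Bernoulli number, NO Selmer count;
* **C♭_Ш** (NEW TEXT; the twist-supply of the same GL(1)-analytic kind as registry v19's Stub C, in Ш-currency) := «∀ class member `W` with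
  `r_an(W) = 1` and `Ш(W/ℚ)[p] = 0`, ∃ imaginary quadratic `K` Heegner for `N_W` with `d_K` odd `< −4`, `L(W^{(d_K)},1) ≠ 0`, and SOME
  globally minimal model `Wd` of the twist with `Ш(Wd/ℚ)[p] = 0` (the shape of w5 g4's C_Ш, which also carries a partner clause)».

* §1 `bsdp_twistModel_of_bsdTriple` — Burungale–Flach Cor. 2 on the rank-zero CM twist (route-independent twin of the sockets'
  `EisensteinResourceBdpLine.rankZeroTwistBSDp_of_hasCM`); the Ш-bridges `noPTorsion_of_forall_mem_sha` / `forall_mem_sha_of_noPTorsion` (membership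
  form `∀ s ∈ Ш, p • s = 0 → s = 0`, as in LEAD g11's texts, ⟺ the sockets' subtype form `∀ x : Ш, (p:ℤ) • x = 0 → x = 0`) and
  `exists_sha_of_not_noPTorsion` (`¬ (Ш(W)[p] = 0)` ⟹ B1-sha's premise).
* §2 **`heegnerIndex_of_bsdp_cmRamified`** / **`heegnerIndex_of_bsdp_rankOne`** — B1-prim is NECESSARY: `BSDp W p` (resp. `BSD_p` on every rank-one
  class member) ⟹ the index identity (resp. B1-prim), granted the five `ToricPublishedInputs` conjuncts and Burungale–Flach.
* §3 **`bsdp_of_noPTorsion_of_heegnerIndex_of_twistSupply`** — pointwise: a rank-one member with `Ш(W/ℚ)[p] = 0` has `BSD_p` from B1-prim ∧ C♭_Ш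
  (B1 ∩ small-Selmer IS Heegner `p`-primitivity, modulo the supply); **`stubB1_of_sha_of_heegnerIndex_of_twistSupply`** — registry v19's B1 `stub_bsdp_of_classFactor` VERBATIM ⟸ B1-sha ∧ B1-prim ∧ C♭_Ш,
  granted ONLY Gross–Zagier I.(6.3), Kolyvagin, GZK, modularity, Gross–Zagier I.(7.3), the Heegner-point supply `exists_isHeegnerPoint` (all conjuncts
  of `ToricPublishedInputs`) and Burungale–Flach Cor. 2 — NO Mazur–Wiles, NO Kriz–Li, NO Cassels–Tate; `bsdp_rankOne_of_sha_of_heegnerIndex_of_twistSupply`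
  — the same three hypotheses give `BSD_p` on EVERY rank-one class member (B1-prim and C♭_Ш are not restricted to the irregular locus).

* §4 `level_of_sha_of_heegnerIndex_of_twistSupply` — registry v20's `stub_bsdp_of_level` (B1-level, LEAD g12) ⟸ B1-sha ∧ B1-prim ∧ C♭_Ш.

READING: on this line the crux's arithmetic residue B1 is «`BSD_p` when `Ш[p] ≠ 0`» ∧ «Kolyvagin p-primitivity when `Ш[p] = 0`», modulo a twist
supply; §2 says the primitivity half is forced by `BSD_p` itself. CONDITIONAL on the displayed named facts; ROUTE-INDEPENDENT (no `Theses` import).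
References: Gross–Zagier 1986 I.(6.3), V.§2; Kolyvagin 1990 Thm. A; Burungale–Flach 2024 Cor. 2; Miller 2011 Def. 1.1; W. Zhang 2014 (Kolyvagin's
conjecture at good ordinary primes with surjective `ρ̄` — not this class); crux workfiles `Lines/eisenstein-resource-bdp-line-lead-g11.md` §5,
`…-w3g9-notes.md` §2, `…-w2g8-notes.md` §4.
-/

set_option autoImplicit false
-- `…BirchSwinnertonDyer.BirchSwinnertonDyer.Theorems…` is the problem's mandated namespace (D-0017).
set_option linter.dupNamespace false

noncomputable section

open scoped Classical

namespace Summit.BirchSwinnertonDyer.BirchSwinnertonDyer.Theorems.PrintCFram.ParitySplit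

open WeierstrassCurve NumberField IsDedekindDomain DirichletCharacter
  Literature.NumberTheory.EllipticCurves
  Literature.NumberTheory.EllipticCurves.ModularForms
  Literature.NumberTheory.EllipticCurves.Rank1Residual
  Literature.NumberTheory.EllipticCurves.Rank1Residual.Typed
  Literature.NumberTheory.EllipticCurves.KrizLi2019
  Summit.BirchSwinnertonDyer.Rank1Residual
  Summit.BirchSwinnertonDyer.BirchSwinnertonDyer.Theorems
  Summit.BirchSwinnertonDyer.BirchSwinnertonDyer.Theorems.SchneiderFree
  Summit.BirchSwinnertonDyer.BirchSwinnertonDyer.Theorems.PrintCFram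

/-! ## §1 Two small bridges -/

/-- **`BSD_p` of a globally minimal model of the rank-zero twist of a class member — Burungale–Flach Cor. 2 and modularity.** For `W/ℚ` with
CM and `p` CM-ramified, `K` a number field and `Wd` globally minimal with `C • W^{(d_K)} = Wd` and `L(W^{(d_K)},1) ≠ 0`: `BSDp Wd p` — the twist model is
a CM curve (`hasCM_and_cmRamified_of_smul_quadraticTwist`) of analytic rank `0` (`entireLFunction_smul`), so `Rank1Residual.bsdp_cm_rankZero`. Route-independent
twin of the sockets' `EisensteinResourceBdpLine.rankZeroTwistBSDp_of_hasCM`. CONDITIONAL on the two named facts.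
[cite: BurungaleFlach2024, Thm. 1.1 and Cor. 2] [cite: SilvermanAEC2009, X.5 Cor. 5.4] -/
theorem bsdp_twistModel_of_bsdTriple {p : ℕ} [Fact p.Prime]
    (hBF : bsdTriple_of_hasCM_of_L_one_ne_zero) (hmod : hasEntireLFunction_rat)
    (W : WeierstrassCurve ℚ) [W.IsElliptic] (hCM : W.HasCM) (hram : CMRamified W p)
    (K : Type) [Field K] [NumberField K]
    (Wd : WeierstrassCurve ℚ) [Wd.IsElliptic] [Wd.IsGloballyMinimal]
    (hC : ∃ C : VariableChange ℚ, C • W.quadraticTwist (NumberField.discr K : ℚ) = Wd)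
    (hLt : (W.quadraticTwist (NumberField.discr K : ℚ)).entireLFunction 1 ≠ 0) :
    BSDp Wd p := by
  have hD0 : (NumberField.discr K : ℚ) ≠ 0 := by exact_mod_cast NumberField.discr_ne_zero K
  have hCMd : Wd.HasCM := (hasCM_and_cmRamified_of_smul_quadraticTwist W hCM hram hD0 Wd hC).1
  obtain ⟨C, hCd⟩ := hC
  haveI : (W.quadraticTwist (NumberField.discr K : ℚ)).IsElliptic := W.isElliptic_quadraticTwist hD0
  have hLd1 : Wd.entireLFunction 1 ≠ 0 := by rw [← hCd, entireLFunction_smul]; exact hLt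
  have hrd : Wd.analyticRank = 0 := analyticRank_eq_zero_of_entireLFunction_one_ne_zero Wd hLd1
  exact Rank1Residual.bsdp_cm_rankZero hBF hmod hCMd hrd

/-- **Ш-bridge (membership form ⟹ subtype form).** `Ш(W/ℚ)[p] = 0` stated on elements of `H¹(ℚ, W)` lying in `Ш` with `p • s` (`p : ℕ`), as in
LEAD g11's B1-sha, gives the subtype form `∀ x : Ш, (p : ℤ) • x = 0 → x = 0` used by the Selmer-side sockets (`ParitySplit.bsdp_iff_heegnerIndex_cmRamified`).
[cite: SilvermanAEC2009, X.§4] -/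
theorem noPTorsion_of_forall_mem_sha (W : WeierstrassCurve ℚ) (p : ℕ) (h : ∀ s ∈ W.sha, p • s = 0 → s = 0) :
    ∀ x : W.sha, (p : ℤ) • x = 0 → x = 0 := by
  intro x hx
  have hv := congrArg Subtype.val hx
  rw [AddSubgroupClass.coe_zsmul, ZeroMemClass.coe_zero, natCast_zsmul] at hv
  exact Subtype.ext (h x.1 x.2 hv)

/-- **Ш-bridge (subtype form ⟹ membership form).** [cite: SilvermanAEC2009, X.§4] -/
theorem forall_mem_sha_of_noPTorsion (W : WeierstrassCurve ℚ) (p : ℕ) (h : ∀ x : W.sha, (p : ℤ) • x = 0 → x = 0) :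
    ∀ s ∈ W.sha, p • s = 0 → s = 0 := by
  intro s hs hps
  have hx : (p : ℤ) • (⟨s, hs⟩ : W.sha) = 0 :=
    Subtype.ext (by rw [AddSubgroupClass.coe_zsmul, ZeroMemClass.coe_zero, natCast_zsmul]; exact hps)
  exact congrArg Subtype.val (h ⟨s, hs⟩ hx)

/-- **Ш-bridge (negation).** If `Ш(W/ℚ)[p] ≠ 0` in the form `¬ (∀ s ∈ Ш(W/ℚ), p • s = 0 → s = 0)`, then `∃ s ∈ Ш(W/ℚ), s ≠ 0 ∧ p • s = 0` — the
premise of LEAD g11's B1-sha. [cite: SilvermanAEC2009, X.§4] -/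
theorem exists_sha_of_not_noPTorsion (W : WeierstrassCurve ℚ) (p : ℕ)
    (h : ¬ ∀ s ∈ W.sha, p • s = 0 → s = 0) :
    ∃ s ∈ W.sha, s ≠ 0 ∧ p • s = 0 := by
  push Not at h
  obtain ⟨s, hs, hps, hs0⟩ := h
  exact ⟨s, hs, hs0, hps⟩

/-! ## §2 B1-prim is NECESSARY: `BSD_p` forces the Heegner index identity -/

/-- **`BSD_p(W)` ⟹ the Heegner point is `p`-primitive up to the Manin-type constant**, on the branch `Ш(W)[p] = 0` with a `p`-regular admissible twist.
For a class member (`W/ℚ` globally minimal with CM, `p ≥ 5` CM-ramified, `r_an(W) = 1`) with `BSDp W p` and `Ш(W/ℚ)[p] = 0`, an admissible Heegner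
datum `(N = N_W, K, Dt, H, ι, P)` (`d_K` odd `< −4`, `L(W^{(d_K)},1) ≠ 0`) and a globally minimal model `Wd` of the twist with `Ш(Wd/ℚ)[p] = 0`:
`padicValNat p [W(K):ℤP] = padicValNat p c`. This is `bsdp_iff_heegnerIndex_cmRamified` (`.mp`) with the partner's `BSD_p` discharged by §1.
CONDITIONAL on the named facts; closes no stub. [cite: GrossZagier1986, Thm. I.(6.3) and V.§2 (pp. 310–312)] [cite: BurungaleFlach2024, Thm. 1.1 and Cor. 2]
[cite: Miller2011LMS, §1 and Def. 1.1] -/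
theorem heegnerIndex_of_bsdp_cmRamified {p : ℕ} [Fact p.Prime]
    (hGZ : ∀ (N : ℕ) [NeZero N] (W : WeierstrassCurve ℚ) (K : Type) [Field K] [NumberField K], gross_zagier N W K)
    (hKo : ∀ (N : ℕ) [NeZero N] (W : WeierstrassCurve ℚ) (K : Type) [Field K] [NumberField K], kolyvagin N W K)
    (hGZK : rank_eq_analyticRank_of_analyticRank_le_one) (hmod : hasEntireLFunction_rat) (hGZ73 : GrossZagier1986_thm_I_7_3)
    (hBF : bsdTriple_of_hasCM_of_L_one_ne_zero)
    (W : WeierstrassCurve ℚ) [W.IsElliptic] [W.IsGloballyMinimal] (hCM : W.HasCM) (hram : CMRamified W p) (h5 : 5 ≤ p)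
    (hr : W.analyticRank = 1) (hW : BSDp W p) (h0 : ∀ s ∈ W.sha, p • s = 0 → s = 0)
    (N : ℕ) [NeZero N] (K : Type) [Field K] [NumberField K]
    (Dt : ModularParametrizationData W N) (H : HeegnerDatum N (NumberField.discr K)) (ι : K →+* ℂ)
    (P : (W.baseChange K).toAffine.Point) (Wd : WeierstrassCurve ℚ) [Wd.IsElliptic] [Wd.IsGloballyMinimal]
    (hN : W.conductorNorm ℤ = N) (hK : IsImaginaryQuadratic K) (hHN : SatisfiesHeegnerHypothesis N K)
    (hodd : Odd (NumberField.discr K)) (hd4 : NumberField.discr K < -4)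
    (hLt : (W.quadraticTwist (NumberField.discr K : ℚ)).entireLFunction 1 ≠ 0)
    (hP : WeierstrassCurve.Affine.Point.map ι.toRatAlgHom P = heegnerPointComplex Dt H)
    (hC : ∃ C : VariableChange ℚ, C • W.quadraticTwist (NumberField.discr K : ℚ) = Wd)
    (h0d : ∀ s ∈ Wd.sha, p • s = 0 → s = 0) :
    padicValNat p (AddSubgroup.zmultiples P).index = padicValNat p Dt.c.natAbs :=
  (bsdp_iff_heegnerIndex_cmRamified hGZ hKo hGZK hmod hGZ73 W hCM hram h5 hr N K Dt H ι P Wd hN hK hHN hodd hd4 hLt hP hC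
    (noPTorsion_of_forall_mem_sha W p h0) (noPTorsion_of_forall_mem_sha Wd p h0d)
    (bsdp_twistModel_of_bsdTriple hBF hmod W hCM hram K Wd hC hLt)).mp hW

/-- **B1-prim is NECESSARY for `BSD_p` on the class.** Granted Gross–Zagier I.(6.3), Kolyvagin, GZK, modularity, Gross–Zagier I.(7.3) and
Burungale–Flach Cor. 2: if `BSDp W p` holds for every rank-one class member (CM, globally minimal, `CMRamified W p`, `p ≥ 5`), then **B1-prim** holds —
for every such member with `Ш(W/ℚ)[p] = 0`, every admissible Heegner datum and every `p`-regular globally minimal model of the twist, the Heegner point is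
`p`-primitive up to the Manin-type constant. (With LEAD g11's `EisensteinEndStateV19.bsdp_classFactor_of_bottomClassIndexLawFiveLe_of_imcZp`: the crux
itself, granted (R-IMC)∃-Zp, forces B1-prim.) CONDITIONAL; closes no stub; BSD is not proved by any of this.
[cite: GrossZagier1986, Thm. I.(6.3) and V.§2 (pp. 310–312)] [cite: BurungaleFlach2024, Thm. 1.1 and Cor. 2] [cite: Miller2011LMS, §1 and Def. 1.1] -/
theorem heegnerIndex_of_bsdp_rankOne
    (hGZ : ∀ (N : ℕ) [NeZero N] (W : WeierstrassCurve ℚ) (K : Type) [Field K] [NumberField K], gross_zagier N W K)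
    (hKo : ∀ (N : ℕ) [NeZero N] (W : WeierstrassCurve ℚ) (K : Type) [Field K] [NumberField K], kolyvagin N W K)
    (hGZK : rank_eq_analyticRank_of_analyticRank_le_one) (hmod : hasEntireLFunction_rat) (hGZ73 : GrossZagier1986_thm_I_7_3)
    (hBF : bsdTriple_of_hasCM_of_L_one_ne_zero)
    (hBSD :
    ∀ (W : WeierstrassCurve ℚ) [W.IsElliptic] [W.IsGloballyMinimal] (p : ℕ) [Fact p.Prime],
      W.HasCM → CMRamified W p → 5 ≤ p → W.analyticRank = 1 → BSDp W p) :
    ∀ (W : WeierstrassCurve ℚ) [W.IsElliptic] [W.IsGloballyMinimal] (p : ℕ) [Fact p.Prime],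
      W.HasCM → CMRamified W p → 5 ≤ p → W.analyticRank = 1 →
      (∀ s ∈ W.sha, p • s = 0 → s = 0) →
      ∀ (N : ℕ) [NeZero N] (K : Type) [Field K] [NumberField K]
        (Dt : ModularParametrizationData W N) (H : HeegnerDatum N (NumberField.discr K)) (ι : K →+* ℂ)
        (P : (W.baseChange K).toAffine.Point) (Wd : WeierstrassCurve ℚ) [Wd.IsElliptic] [Wd.IsGloballyMinimal],
        W.conductorNorm ℤ = N → IsImaginaryQuadratic K → SatisfiesHeegnerHypothesis N K →
        Odd (NumberField.discr K) → NumberField.discr K < -4 →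
        (W.quadraticTwist (NumberField.discr K : ℚ)).entireLFunction 1 ≠ 0 →
        WeierstrassCurve.Affine.Point.map ι.toRatAlgHom P = heegnerPointComplex Dt H →
        (∃ C : VariableChange ℚ, C • W.quadraticTwist (NumberField.discr K : ℚ) = Wd) →
        (∀ s ∈ Wd.sha, p • s = 0 → s = 0) →
        padicValNat p (AddSubgroup.zmultiples P).index = padicValNat p Dt.c.natAbs := by
  intro W _ _ p _ hCM hram h5 hr h0 N _ K _ _ Dt H ι P Wd _ _ hN hK hHN hodd hd4 hLt hP hC h0d
  exact heegnerIndex_of_bsdp_cmRamified hGZ hKo hGZK hmod hGZ73 hBF W hCM hram h5 hr (hBSD W p hCM hram h5 hr) h0 N K Dt H ι P Wd hN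
    hK hHN hodd hd4 hLt hP hC h0d

/-! ## §3 B1 ⟸ B1-sha ∧ B1-prim ∧ C♭_Ш — Mazur–Wiles-free, Kriz–Li-free -/

/-- **B1 ∩ small-Selmer IS Heegner `p`-primitivity (modulo the twist supply), pointwise.** For a rank-one class member `W` (CM, globally minimal,
`CMRamified W p`, `p ≥ 5`) with `Ш(W/ℚ)[p] = 0`: B1-prim (`hPrim`) and C♭_Ш (`hSup`) give `BSDp W p`, granted Gross–Zagier I.(6.3), Kolyvagin, GZK, modularity,
Gross–Zagier I.(7.3), the Heegner-point supply and Burungale–Flach Cor. 2. The level binder of B1-level (a `p`-divisible generator) is NOT needed: on the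
branch `Ш[p] = 0` the whole of `BSD_p` is the Heegner index identity at ONE admissible `p`-regular twist (LEAD g12's question (a), STATUS 00:00:49Z).
Proof: `hSup` ⟹ `K`, `Wd`; `exists_isHeegnerPoint` ⟹ `(Dt, H, ι, P)` at level `N_W`; §1 ⟹ `BSDp Wd p`; `hPrim` ⟹ the identity;
`bsdp_iff_heegnerIndex_cmRamified` (`.mpr`). MAZUR–WILES-FREE, KRIZ–LI-FREE. CONDITIONAL; BSD is not proved by any of this.
[cite: GrossZagier1986, I.§4, Thm. I.(6.3) and V.§2 (pp. 310–312)] [cite: Kolyvagin1990, Thm. A] [cite: BurungaleFlach2024, Thm. 1.1 and Cor. 2] -/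
theorem bsdp_of_noPTorsion_of_heegnerIndex_of_twistSupply
    (hGZ : ∀ (N : ℕ) [NeZero N] (W : WeierstrassCurve ℚ) (K : Type) [Field K] [NumberField K], gross_zagier N W K)
    (hKo : ∀ (N : ℕ) [NeZero N] (W : WeierstrassCurve ℚ) (K : Type) [Field K] [NumberField K], kolyvagin N W K)
    (hGZK : rank_eq_analyticRank_of_analyticRank_le_one) (hmod : hasEntireLFunction_rat) (hGZ73 : GrossZagier1986_thm_I_7_3)
    (hHP : ∀ (W : WeierstrassCurve ℚ) (K : Type) [Field K] [NumberField K], exists_isHeegnerPoint W K)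
    (hBF : bsdTriple_of_hasCM_of_L_one_ne_zero)
    (hPrim :
    ∀ (W : WeierstrassCurve ℚ) [W.IsElliptic] [W.IsGloballyMinimal] (p : ℕ) [Fact p.Prime],
      W.HasCM → CMRamified W p → 5 ≤ p → W.analyticRank = 1 →
      (∀ s ∈ W.sha, p • s = 0 → s = 0) →
      ∀ (N : ℕ) [NeZero N] (K : Type) [Field K] [NumberField K]
        (Dt : ModularParametrizationData W N) (H : HeegnerDatum N (NumberField.discr K)) (ι : K →+* ℂ)
        (P : (W.baseChange K).toAffine.Point) (Wd : WeierstrassCurve ℚ) [Wd.IsElliptic] [Wd.IsGloballyMinimal],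
        W.conductorNorm ℤ = N → IsImaginaryQuadratic K → SatisfiesHeegnerHypothesis N K →
        Odd (NumberField.discr K) → NumberField.discr K < -4 →
        (W.quadraticTwist (NumberField.discr K : ℚ)).entireLFunction 1 ≠ 0 →
        WeierstrassCurve.Affine.Point.map ι.toRatAlgHom P = heegnerPointComplex Dt H →
        (∃ C : VariableChange ℚ, C • W.quadraticTwist (NumberField.discr K : ℚ) = Wd) →
        (∀ s ∈ Wd.sha, p • s = 0 → s = 0) →
        padicValNat p (AddSubgroup.zmultiples P).index = padicValNat p Dt.c.natAbs)
    (hSup :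
    ∀ (W : WeierstrassCurve ℚ) [W.IsElliptic] [W.IsGloballyMinimal] (p : ℕ) [Fact p.Prime],
      W.HasCM → CMRamified W p → 5 ≤ p → W.analyticRank = 1 →
      (∀ s ∈ W.sha, p • s = 0 → s = 0) →
      ∃ (K : Type) (_ : Field K) (_ : NumberField K),
        IsImaginaryQuadratic K ∧ SatisfiesHeegnerHypothesis (W.conductorNorm ℤ) K ∧ Odd (NumberField.discr K) ∧
        NumberField.discr K < -4 ∧ (W.quadraticTwist (NumberField.discr K : ℚ)).entireLFunction 1 ≠ 0 ∧
        ∃ (Wd : WeierstrassCurve ℚ) (_ : Wd.IsElliptic) (_ : Wd.IsGloballyMinimal),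
          (∃ C : VariableChange ℚ, C • W.quadraticTwist (NumberField.discr K : ℚ) = Wd) ∧
          ∀ s ∈ Wd.sha, p • s = 0 → s = 0) (W : WeierstrassCurve ℚ) [W.IsElliptic] [W.IsGloballyMinimal] (p : ℕ) [Fact p.Prime]
    (hCM : W.HasCM) (hram : CMRamified W p) (h5 : 5 ≤ p) (hr : W.analyticRank = 1)
    (h0 : ∀ s ∈ W.sha, p • s = 0 → s = 0) : BSDp W p := by
  obtain ⟨K, _, _, hK, hHN, hodd, hd4, hLt, Wd, _, _, hC, h0d⟩ := hSup W p hCM hram h5 hr h0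
  haveI hN0 : NeZero (W.conductorNorm ℤ) := ⟨W.conductorNorm_pos_holds.ne'⟩
  obtain ⟨P, Dt, H, ι, hP⟩ := hHP W K hK hHN
  have hWd : BSDp Wd p := bsdp_twistModel_of_bsdTriple hBF hmod W hCM hram K Wd hC hLt
  have hidx := hPrim W p hCM hram h5 hr h0 (W.conductorNorm ℤ) K Dt H ι P Wd rfl hK hHN hodd hd4 hLt hP hC h0d
  exact (bsdp_iff_heegnerIndex_cmRamified hGZ hKo hGZK hmod hGZ73 W hCM hram h5 hr (W.conductorNorm ℤ) K Dt H ι P Wd rfl hK hHN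
    hodd hd4 hLt hP hC (noPTorsion_of_forall_mem_sha W p h0) (noPTorsion_of_forall_mem_sha Wd p h0d) hWd).mpr hidx

/-- **`BSD_p` ON EVERY RANK-ONE CLASS MEMBER ⟸ B1-sha ∧ B1-prim ∧ C♭_Ш**, granted Gross–Zagier I.(6.3) (`hGZ`), Kolyvagin (`hKo`), GZK (`hGZK`),
modularity (`hmod`), Gross–Zagier I.(7.3) (`hGZ73`), the Heegner-point supply `exists_isHeegnerPoint` (`hHP`) — all conjuncts of `ToricPublishedInputs` —
and Burungale–Flach Cor. 2 (`hBF`). For a class member `W` (CM, globally minimal, `CMRamified W p`, `p ≥ 5`, `r_an(W) = 1`): if `Ш(W/ℚ)[p] ≠ 0`,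
B1-sha (`hSha`, LEAD g11's text; bridge `exists_sha_of_not_noPTorsion`); if `Ш(W/ℚ)[p] = 0`, the supply `hSup` hands an admissible Heegner `K`
(`d_K` odd `< −4`, `L(W^{(d_K)},1) ≠ 0`) with a `p`-regular globally minimal twist model `Wd`, `exists_isHeegnerPoint` hands the Heegner datum
`(Dt, H, ι, P)` at level `N_W`, §1 the `BSD_p` of the supplied minimal twist model `Wd`, B1-prim (`hPrim`) the index identity, and `bsdp_iff_heegnerIndex_cmRamified` (`.mpr`) descends to `BSDp W p`. NO Mazur–Wiles, NO Kriz–Li, NO Cassels–Tate, NO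
character. CONDITIONAL on the three research hypotheses and the named facts; closes no stub; BSD is not proved by any of this.
[cite: GrossZagier1986, I.§4, Thm. I.(6.3) and V.§2 (pp. 310–312)] [cite: Kolyvagin1990, Thm. A] [cite: BurungaleFlach2024, Thm. 1.1 and Cor. 2]
[cite: SilvermanAEC2009, VIII.8 Cor. 8.3 and X.§4] [cite: Miller2011LMS, §1 and Def. 1.1] -/
theorem bsdp_rankOne_of_sha_of_heegnerIndex_of_twistSupply
    (hGZ : ∀ (N : ℕ) [NeZero N] (W : WeierstrassCurve ℚ) (K : Type) [Field K] [NumberField K], gross_zagier N W K)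
    (hKo : ∀ (N : ℕ) [NeZero N] (W : WeierstrassCurve ℚ) (K : Type) [Field K] [NumberField K], kolyvagin N W K)
    (hGZK : rank_eq_analyticRank_of_analyticRank_le_one) (hmod : hasEntireLFunction_rat) (hGZ73 : GrossZagier1986_thm_I_7_3)
    (hHP : ∀ (W : WeierstrassCurve ℚ) (K : Type) [Field K] [NumberField K], exists_isHeegnerPoint W K)
    (hBF : bsdTriple_of_hasCM_of_L_one_ne_zero)
    (hSha :
    ∀ (W : WeierstrassCurve ℚ) [W.IsElliptic] [W.IsGloballyMinimal] (p : ℕ) [Fact p.Prime],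
      W.HasCM → CMRamified W p → 5 ≤ p → W.analyticRank = 1 →
      (∃ s ∈ W.sha, s ≠ 0 ∧ p • s = 0) → BSDp W p)
    (hPrim :
    ∀ (W : WeierstrassCurve ℚ) [W.IsElliptic] [W.IsGloballyMinimal] (p : ℕ) [Fact p.Prime],
      W.HasCM → CMRamified W p → 5 ≤ p → W.analyticRank = 1 →
      (∀ s ∈ W.sha, p • s = 0 → s = 0) →
      ∀ (N : ℕ) [NeZero N] (K : Type) [Field K] [NumberField K]
        (Dt : ModularParametrizationData W N) (H : HeegnerDatum N (NumberField.discr K)) (ι : K →+* ℂ)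
        (P : (W.baseChange K).toAffine.Point) (Wd : WeierstrassCurve ℚ) [Wd.IsElliptic] [Wd.IsGloballyMinimal],
        W.conductorNorm ℤ = N → IsImaginaryQuadratic K → SatisfiesHeegnerHypothesis N K →
        Odd (NumberField.discr K) → NumberField.discr K < -4 →
        (W.quadraticTwist (NumberField.discr K : ℚ)).entireLFunction 1 ≠ 0 →
        WeierstrassCurve.Affine.Point.map ι.toRatAlgHom P = heegnerPointComplex Dt H →
        (∃ C : VariableChange ℚ, C • W.quadraticTwist (NumberField.discr K : ℚ) = Wd) →
        (∀ s ∈ Wd.sha, p • s = 0 → s = 0) →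
        padicValNat p (AddSubgroup.zmultiples P).index = padicValNat p Dt.c.natAbs)
    (hSup :
    ∀ (W : WeierstrassCurve ℚ) [W.IsElliptic] [W.IsGloballyMinimal] (p : ℕ) [Fact p.Prime],
      W.HasCM → CMRamified W p → 5 ≤ p → W.analyticRank = 1 →
      (∀ s ∈ W.sha, p • s = 0 → s = 0) →
      ∃ (K : Type) (_ : Field K) (_ : NumberField K),
        IsImaginaryQuadratic K ∧ SatisfiesHeegnerHypothesis (W.conductorNorm ℤ) K ∧ Odd (NumberField.discr K) ∧
        NumberField.discr K < -4 ∧ (W.quadraticTwist (NumberField.discr K : ℚ)).entireLFunction 1 ≠ 0 ∧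
        ∃ (Wd : WeierstrassCurve ℚ) (_ : Wd.IsElliptic) (_ : Wd.IsGloballyMinimal),
          (∃ C : VariableChange ℚ, C • W.quadraticTwist (NumberField.discr K : ℚ) = Wd) ∧
          ∀ s ∈ Wd.sha, p • s = 0 → s = 0) :
    ∀ (W : WeierstrassCurve ℚ) [W.IsElliptic] [W.IsGloballyMinimal] (p : ℕ) [Fact p.Prime],
      W.HasCM → CMRamified W p → 5 ≤ p → W.analyticRank = 1 → BSDp W p := by
  intro W _ _ p _ hCM hram h5 hr
  by_cases h0 : ∀ s ∈ W.sha, p • s = 0 → s = 0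
  · -- small-Selmer branch: Heegner `p`-primitivity
    exact bsdp_of_noPTorsion_of_heegnerIndex_of_twistSupply hGZ hKo hGZK hmod hGZ73 hHP hBF hPrim hSup W p hCM hram h5 hr h0
  · -- `Ш(W)[p] ≠ 0`: B1-sha
    exact hSha W p hCM hram h5 hr (exists_sha_of_not_noPTorsion W p h0)

/-- **REGISTRY v19's B1 `stub_bsdp_of_classFactor`, VERBATIM, ⟸ B1-sha ∧ B1-prim ∧ C♭_Ш** (granted the `ToricPublishedInputs` conjuncts Gross–Zagier
I.(6.3), Kolyvagin, GZK, modularity, Gross–Zagier I.(7.3), `exists_isHeegnerPoint`, and Burungale–Flach Cor. 2): the Bernoulli premise of B1 is not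
even used — `bsdp_rankOne_of_sha_of_heegnerIndex_of_twistSupply` gives `BSD_p` on every rank-one member. THE KOLYVAGIN READING OF THE LINE'S ARITHMETIC
RESIDUE: B1 = «`BSD_p` when `Ш[p] ≠ 0`» ∧ «Heegner `p`-primitivity when `Ш[p] = 0`» (mod the twist supply) — MAZUR–WILES-FREE, unlike the binder pair
B1-level/B1-sha of `EisensteinEndStateV19Binders.stubB1_of_stubB1Level_of_stubB1Sha`. CONDITIONAL; closes no stub; BSD is not proved by any of this.
[cite: GrossZagier1986, I.§4, Thm. I.(6.3) and V.§2 (pp. 310–312)] [cite: Kolyvagin1990, Thm. A] [cite: BurungaleFlach2024, Thm. 1.1 and Cor. 2]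
[cite: KrizLi2019, Thm. 1.20 (pp. 7–8), (29) (pp. 49–50)] -/
theorem stubB1_of_sha_of_heegnerIndex_of_twistSupply
    (hGZ : ∀ (N : ℕ) [NeZero N] (W : WeierstrassCurve ℚ) (K : Type) [Field K] [NumberField K], gross_zagier N W K)
    (hKo : ∀ (N : ℕ) [NeZero N] (W : WeierstrassCurve ℚ) (K : Type) [Field K] [NumberField K], kolyvagin N W K)
    (hGZK : rank_eq_analyticRank_of_analyticRank_le_one) (hmod : hasEntireLFunction_rat) (hGZ73 : GrossZagier1986_thm_I_7_3)
    (hHP : ∀ (W : WeierstrassCurve ℚ) (K : Type) [Field K] [NumberField K], exists_isHeegnerPoint W K)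
    (hBF : bsdTriple_of_hasCM_of_L_one_ne_zero)
    (hSha :
    ∀ (W : WeierstrassCurve ℚ) [W.IsElliptic] [W.IsGloballyMinimal] (p : ℕ) [Fact p.Prime],
      W.HasCM → CMRamified W p → 5 ≤ p → W.analyticRank = 1 →
      (∃ s ∈ W.sha, s ≠ 0 ∧ p • s = 0) → BSDp W p)
    (hPrim :
    ∀ (W : WeierstrassCurve ℚ) [W.IsElliptic] [W.IsGloballyMinimal] (p : ℕ) [Fact p.Prime],
      W.HasCM → CMRamified W p → 5 ≤ p → W.analyticRank = 1 →
      (∀ s ∈ W.sha, p • s = 0 → s = 0) →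
      ∀ (N : ℕ) [NeZero N] (K : Type) [Field K] [NumberField K]
        (Dt : ModularParametrizationData W N) (H : HeegnerDatum N (NumberField.discr K)) (ι : K →+* ℂ)
        (P : (W.baseChange K).toAffine.Point) (Wd : WeierstrassCurve ℚ) [Wd.IsElliptic] [Wd.IsGloballyMinimal],
        W.conductorNorm ℤ = N → IsImaginaryQuadratic K → SatisfiesHeegnerHypothesis N K →
        Odd (NumberField.discr K) → NumberField.discr K < -4 →
        (W.quadraticTwist (NumberField.discr K : ℚ)).entireLFunction 1 ≠ 0 →
        WeierstrassCurve.Affine.Point.map ι.toRatAlgHom P = heegnerPointComplex Dt H →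
        (∃ C : VariableChange ℚ, C • W.quadraticTwist (NumberField.discr K : ℚ) = Wd) →
        (∀ s ∈ Wd.sha, p • s = 0 → s = 0) →
        padicValNat p (AddSubgroup.zmultiples P).index = padicValNat p Dt.c.natAbs)
    (hSup :
    ∀ (W : WeierstrassCurve ℚ) [W.IsElliptic] [W.IsGloballyMinimal] (p : ℕ) [Fact p.Prime],
      W.HasCM → CMRamified W p → 5 ≤ p → W.analyticRank = 1 →
      (∀ s ∈ W.sha, p • s = 0 → s = 0) →
      ∃ (K : Type) (_ : Field K) (_ : NumberField K),
        IsImaginaryQuadratic K ∧ SatisfiesHeegnerHypothesis (W.conductorNorm ℤ) K ∧ Odd (NumberField.discr K) ∧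
        NumberField.discr K < -4 ∧ (W.quadraticTwist (NumberField.discr K : ℚ)).entireLFunction 1 ≠ 0 ∧
        ∃ (Wd : WeierstrassCurve ℚ) (_ : Wd.IsElliptic) (_ : Wd.IsGloballyMinimal),
          (∃ C : VariableChange ℚ, C • W.quadraticTwist (NumberField.discr K : ℚ) = Wd) ∧
          ∀ s ∈ Wd.sha, p • s = 0 → s = 0) :
    ∀ (W : WeierstrassCurve ℚ) [W.IsElliptic] [W.IsGloballyMinimal] (p : ℕ) [Fact p.Prime],
      W.HasCM → CMRamified W p → 5 ≤ p → W.analyticRank = 1 →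
      ∀ (f : ℕ) [NeZero f] (ψ : DirichletCharacter ℚ_[p] f) (ω : DirichletCharacter ℚ_[p] p),
        ψ.Odd → IsTeichmullerCharacter ω →
        (∀ ℓ : ℕ, ℓ.Prime → ¬ (ℓ ∣ p * W.conductorNorm ℤ) →
          ‖((W.LFunction ℓ : ℤ) : ℚ_[p]) - (ψ (ℓ : ZMod f) + ψ⁻¹ (ℓ : ZMod f) * ω (ℓ : ZMod p))‖ < 1) →
        ‖bernoulliOnePrim ψ⁻¹‖ ≤ (p : ℝ)⁻¹ →
        BSDp W p := by
  intro W _ _ p _ hCM hram h5 hr _ _ _ _ _ _ _ _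
  exact bsdp_rankOne_of_sha_of_heegnerIndex_of_twistSupply hGZ hKo hGZK hmod hGZ73 hHP hBF hSha hPrim hSup W p hCM hram h5 hr

/-! ## §4 Registry v20's stub `stub_bsdp_of_level` (B1-level) from the Kolyvagin pair -/

/-- **B1-level ⟸ B1-sha ∧ B1-prim ∧ C♭_Ш** (granted Gross–Zagier I.(6.3), Kolyvagin, GZK, modularity, Gross–Zagier I.(7.3), the Heegner-point supply,
Burungale–Flach Cor. 2 — MAZUR–WILES-FREE, KRIZ–LI-FREE). B1-level is LEAD g11's `hLevel` = registry v20's `stub_bsdp_of_level` VERBATIM («`BSD_p` for every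
rank-one class member whose generator is `p`-divisible in `W(ℚ_p)`»); its level binder is not used — `bsdp_rankOne_of_sha_of_heegnerIndex_of_twistSupply`
gives `BSD_p` on every rank-one member. With `bsdp_of_noPTorsion_of_heegnerIndex_of_twistSupply`: **B1-level ∩ {Ш[p] = 0} ⟸ B1-prim ∧ C♭_Ш** and
**B1-level ∩ {Ш[p] ≠ 0} ⊆ B1-sha**. CONDITIONAL; closes no stub (hypothesis-taking); BSD is not proved by any of this.
[cite: GrossZagier1986, I.§4, Thm. I.(6.3) and V.§2 (pp. 310–312)] [cite: Kolyvagin1990, Thm. A] [cite: BurungaleFlach2024, Thm. 1.1 and Cor. 2] -/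
theorem level_of_sha_of_heegnerIndex_of_twistSupply
    (hGZ : ∀ (N : ℕ) [NeZero N] (W : WeierstrassCurve ℚ) (K : Type) [Field K] [NumberField K], gross_zagier N W K)
    (hKo : ∀ (N : ℕ) [NeZero N] (W : WeierstrassCurve ℚ) (K : Type) [Field K] [NumberField K], kolyvagin N W K)
    (hGZK : rank_eq_analyticRank_of_analyticRank_le_one) (hmod : hasEntireLFunction_rat) (hGZ73 : GrossZagier1986_thm_I_7_3)
    (hHP : ∀ (W : WeierstrassCurve ℚ) (K : Type) [Field K] [NumberField K], exists_isHeegnerPoint W K)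
    (hBF : bsdTriple_of_hasCM_of_L_one_ne_zero)
    (hSha :
    ∀ (W : WeierstrassCurve ℚ) [W.IsElliptic] [W.IsGloballyMinimal] (p : ℕ) [Fact p.Prime],
      W.HasCM → CMRamified W p → 5 ≤ p → W.analyticRank = 1 →
      (∃ s ∈ W.sha, s ≠ 0 ∧ p • s = 0) → BSDp W p)
    (hPrim :
    ∀ (W : WeierstrassCurve ℚ) [W.IsElliptic] [W.IsGloballyMinimal] (p : ℕ) [Fact p.Prime],
      W.HasCM → CMRamified W p → 5 ≤ p → W.analyticRank = 1 →
      (∀ s ∈ W.sha, p • s = 0 → s = 0) →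
      ∀ (N : ℕ) [NeZero N] (K : Type) [Field K] [NumberField K]
        (Dt : ModularParametrizationData W N) (H : HeegnerDatum N (NumberField.discr K)) (ι : K →+* ℂ)
        (P : (W.baseChange K).toAffine.Point) (Wd : WeierstrassCurve ℚ) [Wd.IsElliptic] [Wd.IsGloballyMinimal],
        W.conductorNorm ℤ = N → IsImaginaryQuadratic K → SatisfiesHeegnerHypothesis N K →
        Odd (NumberField.discr K) → NumberField.discr K < -4 →
        (W.quadraticTwist (NumberField.discr K : ℚ)).entireLFunction 1 ≠ 0 →
        WeierstrassCurve.Affine.Point.map ι.toRatAlgHom P = heegnerPointComplex Dt H →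
        (∃ C : VariableChange ℚ, C • W.quadraticTwist (NumberField.discr K : ℚ) = Wd) →
        (∀ s ∈ Wd.sha, p • s = 0 → s = 0) →
        padicValNat p (AddSubgroup.zmultiples P).index = padicValNat p Dt.c.natAbs)
    (hSup :
    ∀ (W : WeierstrassCurve ℚ) [W.IsElliptic] [W.IsGloballyMinimal] (p : ℕ) [Fact p.Prime],
      W.HasCM → CMRamified W p → 5 ≤ p → W.analyticRank = 1 →
      (∀ s ∈ W.sha, p • s = 0 → s = 0) →
      ∃ (K : Type) (_ : Field K) (_ : NumberField K),
        IsImaginaryQuadratic K ∧ SatisfiesHeegnerHypothesis (W.conductorNorm ℤ) K ∧ Odd (NumberField.discr K) ∧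
        NumberField.discr K < -4 ∧ (W.quadraticTwist (NumberField.discr K : ℚ)).entireLFunction 1 ≠ 0 ∧
        ∃ (Wd : WeierstrassCurve ℚ) (_ : Wd.IsElliptic) (_ : Wd.IsGloballyMinimal),
          (∃ C : VariableChange ℚ, C • W.quadraticTwist (NumberField.discr K : ℚ) = Wd) ∧
          ∀ s ∈ Wd.sha, p • s = 0 → s = 0) :
    ∀ (W : WeierstrassCurve ℚ) [W.IsElliptic] [W.IsGloballyMinimal] (p : ℕ) [Fact p.Prime],
      W.HasCM → CMRamified W p → 5 ≤ p → W.analyticRank = 1 →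
      ∀ P : W.toAffine.Point, ¬ IsOfFinAddOrder P →
        (∀ R : W.toAffine.Point, ∃ (k : ℤ) (T : W.toAffine.Point), IsOfFinAddOrder T ∧ R = k • P + T) →
        (∃ Q : (W.baseChange ℚ_[p]).toAffine.Point, p • Q = W.toPadicPoint p P) →
        BSDp W p :=
  fun W _ _ p _ hCM hram h5 hr _ _ _ _ ↦
    bsdp_rankOne_of_sha_of_heegnerIndex_of_twistSupply hGZ hKo hGZK hmod hGZ73 hHP hBF hSha hPrim hSup W p hCM hram h5 hr

end Summit.BirchSwinnertonDyer.BirchSwinnertonDyer.Theorems.PrintCFram.ParitySplit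

end
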